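import Literature.NumberTheory.Sieve.CFSemigroupEigenfunctionUnique
import HarnessLib

/-!
# Log-Lipschitz regularisation by the transfer operator of `Γ_A` (cone invariance)

Support file (all results proved) for the named fact
`Literature.NumberTheory.Sieve.MageeOhWinter2019_uniformCounting` (`CFSemigroupCounting.lean`).
The spectral-gap part (3) of [MageeOhWinter2019, Thm. 10] (Ruelle–Perron–Frobenius) rests on
the fact that the transfer operator improves the regularity of positive functions: it maps the
cone `C_K = {f > 0 : f(x) ≤ e^{K|x-y|} f(y)}` of log-Lipschitz functions into a cone with a
smaller constant, because the inverse branches contract and the weights have bounded distortion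
(Birkhoff-cone / Lasota–Yorke mechanism). For the transfer operator `L_s` of the continued
fractions semigroup on `[0,1]` we prove the quantitative form:

* `cfTransfer_iterate_logLip`: if `f > 0` on `[0,1]` and `f(x) ≤ e^{K|x-y|} f(y)` on `[0,1]`
  (`K ≥ 0`, `s ≥ 0`), then `(L_sⁿ f)(x) ≤ e^{(2s + K·2^{1-n})|x-y|} (L_sⁿ f)(y)` on `[0,1]` — the
  weights contribute `2s` (`cfDenom_rpow_le_exp_mul`) and the branches `M_w` contract by
  `q(w)^{-2} ≤ 2^{1-n}` (`abs_cfMoeb_sub_cfMoeb_le`);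
* `cfTransfer_iterate_two_logLip`: in particular `L_s²` maps `C_K` into `C_{2s + K/2} ⊆ C_K` for
  `K ≥ 4s` (strict cone invariance);
* `cfTransfer_iterate_pos_of_pos`: `L_sⁿ` preserves positivity on `[0,1]`.

## References

* M. Magee, H. Oh, D. Winter, J. reine angew. Math. 753 (2019) 89–135, Thm. 10 (after Naud
  [14]). [MageeOhWinter2019]
* C. Liverani, *Decay of correlations*, Ann. of Math. 142 (1995) 239–301, §1 (cones of
  log-Lipschitz functions).
-/

noncomputable section

open Filter Set
open scoped Topology

namespace Literature.NumberTheory.Sieve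

variable {A : Finset ℕ} {n : ℕ}

/-- Contraction of the branches: `|M_w x - M_w y| ≤ 2^{1-n} |x - y|` on `[0,1]` for `w ∈ Aⁿ`
(`q(w)² ≥ 2^{n-1}`). [cite: MageeOhWinter2019, §2.1 Prop. 5] -/
theorem abs_cfMoeb_sub_le_geom {w : Fin n → ℕ} (hw : ∀ i, 1 ≤ w i) {x y : ℝ}
    (hx : x ∈ Icc (0 : ℝ) 1) (hy : y ∈ Icc (0 : ℝ) 1) :
    |cfMoeb (cfMat w) x - cfMoeb (cfMat w) y| ≤ (1 / 2 : ℝ) ^ (n - 1) * |x - y| := by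
  have h := abs_cfMoeb_sub_cfMoeb_le hw hx hy
  have hq : (2 : ℝ) ^ (n - 1) ≤ (cfQ w : ℝ) ^ 2 := by exact_mod_cast pow_le_cfQ_sq hw
  have h2 : (0 : ℝ) < (2 : ℝ) ^ (n - 1) := by positivity
  calc |cfMoeb (cfMat w) x - cfMoeb (cfMat w) y| ≤ |x - y| / (cfQ w : ℝ) ^ 2 := h
    _ ≤ |x - y| / (2 : ℝ) ^ (n - 1) := div_le_div_of_nonneg_left (abs_nonneg _) h2 hq
    _ = (1 / 2 : ℝ) ^ (n - 1) * |x - y| := by rw [one_div_pow, div_eq_mul_one_div, mul_comm]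

/-- The log-Lipschitz bound controls ratios: `f(x) ≤ e^{K} f(y)` for all `x, y ∈ [0,1]`.
[folklore] -/
theorem le_exp_mul_of_logLip {f : ℝ → ℝ} {K : ℝ} (hK : 0 ≤ K)
    (hf : ∀ x ∈ Icc (0 : ℝ) 1, ∀ y ∈ Icc (0 : ℝ) 1, f x ≤ Real.exp (K * |x - y|) * f y)
    (hfpos : ∀ y ∈ Icc (0 : ℝ) 1, 0 < f y) {x y : ℝ} (hx : x ∈ Icc (0 : ℝ) 1) (hy : y ∈ Icc (0 : ℝ) 1) :
    f x ≤ Real.exp K * f y := by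
  have hxy : |x - y| ≤ 1 := by rw [abs_le]; constructor <;> linarith [hx.1, hx.2, hy.1, hy.2]
  have hexp : Real.exp (K * |x - y|) ≤ Real.exp K := Real.exp_le_exp.2 (by nlinarith [abs_nonneg (x - y)])
  exact (hf x hx y hy).trans (mul_le_mul_of_nonneg_right hexp (hfpos y hy).le)

section Cone

variable (hA : ∀ a ∈ A, 1 ≤ a)
include hA

/-- **`L_sⁿ` preserves positivity** on `[0,1]` (`A ≠ ∅`). [folklore] -/
theorem cfTransfer_iterate_pos_of_pos (hne : A.Nonempty) (s : ℝ) (n : ℕ) {f : ℝ → ℝ}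
    (hf : ∀ y ∈ Icc (0 : ℝ) 1, 0 < f y) {x : ℝ} (hx : x ∈ Icc (0 : ℝ) 1) :
    0 < (cfTransfer A s)^[n] f x := by
  haveI : Nonempty A := hne.to_subtype
  rw [cfTransfer_iterate hA s f n hx, cfTransferSum]
  refine Finset.sum_pos (fun w _ => mul_pos ?_ (hf _ (cfMoeb_cfMat_mem (one_le_coe_digit hA w) hx)))
    Finset.univ_nonempty
  exact Real.rpow_pos_of_pos (pow_pos (cfDenom_cfMat_pos (one_le_coe_digit hA w) hx) 2) _

/-- **Log-Lipschitz regularisation by `L_sⁿ`:** if `f > 0` and `f(x) ≤ e^{K|x-y|} f(y)` on `[0,1]`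
(`K, s ≥ 0`), then `(L_sⁿ f)(x) ≤ e^{(2s + K 2^{1-n})|x-y|} (L_sⁿ f)(y)` on `[0,1]`.
[cite: MageeOhWinter2019, Thm. 10] -/
theorem cfTransfer_iterate_logLip {s : ℝ} (hs : 0 ≤ s) (n : ℕ) {f : ℝ → ℝ} {K : ℝ} (hK : 0 ≤ K)
    (hfpos : ∀ y ∈ Icc (0 : ℝ) 1, 0 < f y)
    (hf : ∀ x ∈ Icc (0 : ℝ) 1, ∀ y ∈ Icc (0 : ℝ) 1, f x ≤ Real.exp (K * |x - y|) * f y)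
    {x y : ℝ} (hx : x ∈ Icc (0 : ℝ) 1) (hy : y ∈ Icc (0 : ℝ) 1) :
    (cfTransfer A s)^[n] f x ≤
      Real.exp ((2 * s + K * (1 / 2 : ℝ) ^ (n - 1)) * |x - y|) * (cfTransfer A s)^[n] f y := by
  rw [cfTransfer_iterate hA s f n hx, cfTransfer_iterate hA s f n hy, cfTransferSum, cfTransferSum,
    Finset.mul_sum]
  refine Finset.sum_le_sum fun w _ => ?_
  have hw : ∀ i, 1 ≤ (fun i => (w i : ℕ)) i := one_le_coe_digit hA w
  have hMx := cfMoeb_cfMat_mem hw hx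
  have hMy := cfMoeb_cfMat_mem hw hy
  -- weights: `wt(x) ≤ e^{2s|x-y|} wt(y)`
  have hwt := cfDenom_rpow_le_exp_mul hw hs hx hy
  -- function: `f(M_w x) ≤ e^{K |M_w x - M_w y|} f(M_w y) ≤ e^{K 2^{1-n}|x-y|} f(M_w y)`
  have hfM := hf _ hMx _ hMy
  have hcontr := abs_cfMoeb_sub_le_geom hw hx hy
  have hexpf : Real.exp (K * |cfMoeb (cfMat fun i => (w i : ℕ)) x - cfMoeb (cfMat fun i => (w i : ℕ)) y|) ≤
      Real.exp (K * ((1 / 2 : ℝ) ^ (n - 1) * |x - y|)) :=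
    Real.exp_le_exp.2 (mul_le_mul_of_nonneg_left hcontr hK)
  have hfy : 0 < f (cfMoeb (cfMat fun i => (w i : ℕ)) y) := hfpos _ hMy
  have hwty : 0 ≤ ((cfDenom (cfMat fun i => (w i : ℕ)) y) ^ 2) ^ (-s) := Real.rpow_nonneg (sq_nonneg _) _
  have hwtx : 0 ≤ ((cfDenom (cfMat fun i => (w i : ℕ)) x) ^ 2) ^ (-s) := Real.rpow_nonneg (sq_nonneg _) _
  have hfbound : f (cfMoeb (cfMat fun i => (w i : ℕ)) x) ≤
      Real.exp (K * ((1 / 2 : ℝ) ^ (n - 1) * |x - y|)) * f (cfMoeb (cfMat fun i => (w i : ℕ)) y) :=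
    hfM.trans (mul_le_mul_of_nonneg_right hexpf hfy.le)
  have hsplit : Real.exp ((2 * s + K * (1 / 2 : ℝ) ^ (n - 1)) * |x - y|) =
      Real.exp (2 * s * |x - y|) * Real.exp (K * ((1 / 2 : ℝ) ^ (n - 1) * |x - y|)) := by
    rw [← Real.exp_add]; congr 1; ring
  calc ((cfDenom (cfMat fun i => (w i : ℕ)) x) ^ 2) ^ (-s) * f (cfMoeb (cfMat fun i => (w i : ℕ)) x)
      ≤ (Real.exp (2 * s * |x - y|) * ((cfDenom (cfMat fun i => (w i : ℕ)) y) ^ 2) ^ (-s)) *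
          (Real.exp (K * ((1 / 2 : ℝ) ^ (n - 1) * |x - y|)) * f (cfMoeb (cfMat fun i => (w i : ℕ)) y)) :=
        mul_le_mul hwt hfbound (hfpos _ hMx).le (mul_nonneg (Real.exp_pos _).le hwty)
    _ = Real.exp ((2 * s + K * (1 / 2 : ℝ) ^ (n - 1)) * |x - y|) *
          (((cfDenom (cfMat fun i => (w i : ℕ)) y) ^ 2) ^ (-s) * f (cfMoeb (cfMat fun i => (w i : ℕ)) y)) := by
        rw [hsplit]; ring

/-- **Strict cone invariance under `L_s²`:** with `K ≥ 4s`, if `f > 0` and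
`f(x) ≤ e^{K|x-y|} f(y)` on `[0,1]` then `(L_s² f)(x) ≤ e^{(2s + K/2)|x-y|} (L_s² f)(y)` on `[0,1]`,
and `2s + K/2 ≤ K`. [cite: MageeOhWinter2019, Thm. 10] -/
theorem cfTransfer_iterate_two_logLip {s : ℝ} (hs : 0 ≤ s) {f : ℝ → ℝ} {K : ℝ} (hK : 4 * s ≤ K)
    (hfpos : ∀ y ∈ Icc (0 : ℝ) 1, 0 < f y)
    (hf : ∀ x ∈ Icc (0 : ℝ) 1, ∀ y ∈ Icc (0 : ℝ) 1, f x ≤ Real.exp (K * |x - y|) * f y)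
    {x y : ℝ} (hx : x ∈ Icc (0 : ℝ) 1) (hy : y ∈ Icc (0 : ℝ) 1) :
    (cfTransfer A s)^[2] f x ≤ Real.exp ((2 * s + K / 2) * |x - y|) * (cfTransfer A s)^[2] f y ∧
      2 * s + K / 2 ≤ K := by
  have hK0 : 0 ≤ K := by linarith
  have h := cfTransfer_iterate_logLip hA hs 2 hK0 hfpos hf hx hy
  refine ⟨?_, by linarith⟩
  have e : (2 * s + K * (1 / 2 : ℝ) ^ (2 - 1)) * |x - y| = (2 * s + K / 2) * |x - y| := by ring
  rwa [e] at h

end Cone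

end Literature.NumberTheory.Sieve
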